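import Summits.CriticalPhenomena.SAWScalingLimit.Theorems.SAWLoopFugacityFlowSimpleSubseqLimitsStubDomainMarkov
import HarnessLib

/-!
# The domain Markov property of the critical SAW on cell domains, with a forbidden set
(`stub_forbiddenDomainMarkov` of the line `past-shadowing-costs-halves`, crux
`SAWLoopFugacityFlow.SimpleSubseqLimits`, stmt-CriticalPhenomena-4982)

The exact domain Markov property `stub_sawDomainMarkov` (`…StubDomainMarkov.lean`, the case
`F = ∅`) with an extra FORBIDDEN vertex set `F` that the remaining walk must avoid: for a vertex
set `S` connected in `ℤ²`, a mesh `δ > 0`, a prefix `p = [p₀, …, p_K]` with last vertex `t ∉ F`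
and a Borel set `B` of curve classes, the critical SAW law `P(γ) ∝ x_c^{|γ|}` of the cell domain
`U(S, δ)` from `a` to `b` satisfies
`P{prefix = p, γ avoids F after time K, [remaining polyline] ∈ B}
  = P{prefix = p, γ avoids F after time K} · (P^{U(S'', δ)}_{t → b} ∘ curve⁻¹)(B)`,
`S'' = remainingVerts S ({p₀..p_{K-1}} ∪ F) t` — the remaining cell domain with `F` deleted too
(Madras–Slade 1993, §1.2; Lawler–Schramm–Werner 2004, §3.4; Kemppainen–Smirnov 2017, §4.1.6).
This is the identification behind last-exit conditioning (`F` = the vertices of `S` in a closed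
ball about the root, minus the tip).

Proof (`law_prefix_eq_union`) — the landed bijection restricted to suffixes avoiding `F`. If no
SAW has prefix `p`, both sides vanish. Otherwise the prefix of such a SAW is a path `pw : a → t`
with support `p` (`prefixWalk`), and gluing (`glue`) is a bijection from the SAWs of `U(S'', δ)`
from `t` to `b` onto the event {prefix `= p`, no visit to `F` after time `K`}: after the tip a
remaining SAW only visits remaining vertices (`getVert_mem_remainingVerts`), which avoid
`{p₀..p_{K-1}} ∪ F`, and it does not return to `t` (`not_mem_prefix_of_mem_tail_union`,
`getVert_glue_mem_remainingVerts`); conversely the remaining edges of a SAW with prefix `p`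
avoiding `F` after time `K` are edges of `U(S'', δ)_δ` (`drop_edges_mem_union`: by
self-avoidance the remaining vertices avoid `{p₀..p_{K-1}}`, they avoid `F` by hypothesis and
`t ∉ F`, and they are joined to `t` along the walk inside `S`). Lengths add, so the weights
factor as `x_c^K · x_c^{|η|}` (`weight_prefix_inter_union`, a reindexed `tsum`); the identity
follows by `ℝ≥0∞` algebra, the cases `Z_{S''} ∈ {0, ∞}` making both sides `0`. No named facts.
-/

noncomputable section

open MeasureTheory Filter Topology Set
open Literature.Probability.RandomPlanarGeometry Literature.Probability.LatticeModels
open scoped ENNReal NNReal unitInterval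

namespace Summit.CriticalPhenomena.SAWScalingLimit.Theorems.SimpleSubseqLimits.CapacityClock.DomainMarkov

variable {S F : Finset (Site 2)} {δ : ℝ}

section ForbiddenMarkov

variable {a b t : Site 2} {p : List (Site 2)} {K : ℕ} {P : Finset (Site 2)}

/-! ### Remaining SAWs stay among the remaining vertices -/

/-- After its starting time, a SAW of the remaining cell domain `U(remainingVerts S P t, δ)` from
the tip `t` only visits remaining vertices (each such vertex is the head of an edge of the
remaining discrete domain). [folklore] -/
theorem getVert_mem_remainingVerts (hδ : 0 < δ)
    (η : SAW.DomainSAW (cellDomain (remainingVerts S P t) δ) δ t b) {m : ℕ} (h1 : 1 ≤ m)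
    (h2 : m ≤ η.length) : η.walk.getVert m ∈ remainingVerts S P t := by
  obtain ⟨n, rfl⟩ := Nat.exists_eq_add_one_of_ne_zero (Nat.one_le_iff_ne_zero.1 h1)
  exact ((remGraph_adj_iff hδ).1 (η.walk.adj_getVert_succ (Nat.lt_of_succ_le h2))).2.2

/-- **Tails of SAWs of the remaining domain with `F` deleted avoid the prefix**: a vertex after
the tip on a SAW of `U(remainingVerts S ({p₀..p_{K-1}} ∪ F) t, δ)` from `t` is a remaining vertex
(hence not among `p₀..p_{K-1}`) and is not `t`. [folklore] -/
theorem not_mem_prefix_of_mem_tail_union (hδ : 0 < δ) (hpt : p.getLast? = some t)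
    (η : SAW.DomainSAW (cellDomain (remainingVerts S (p.dropLast.toFinset ∪ F) t) δ) δ t b)
    {x : Site 2} (hx : x ∈ η.walk.support.tail) : x ∉ p := by
  obtain ⟨ys, rfl⟩ := List.getLast?_eq_some_iff.1 hpt
  have hnd := (SimpleGraph.Walk.isPath_def _).1 η.isPath
  rw [← SimpleGraph.Walk.cons_tail_support, List.nodup_cons] at hnd
  obtain ⟨y, hy⟩ := exists_adj_of_mem_support_tail η.walk hx
  have hxP := (mem_and_not_mem_of_mem_remainingVerts ((remGraph_adj_iff hδ).1 hy).2.2).2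
  rw [List.dropLast_concat, Finset.mem_union, not_or, List.mem_toFinset] at hxP
  intro hxp
  rw [List.mem_append, List.mem_singleton] at hxp
  rcases hxp with h | rfl
  · exact hxP.1 h
  · exact hnd.1 hx

/-- **A glued SAW only visits remaining vertices after the prefix**: for a prefix path `pw` of
length `K` glued to a SAW `η` of `U(remainingVerts S P t, δ)` from the tip, the vertex at any time
`j` with `K + 1 ≤ j ≤ |pw ++ η|` is a remaining vertex. [folklore] -/
theorem getVert_glue_mem_remainingVerts (hδ : 0 < δ)
    (pw : (discreteDomainGraph (cellDomain S δ) δ).Walk a t) (hpw : pw.IsPath)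
    (hle : discreteDomainGraph (cellDomain (remainingVerts S P t) δ) δ ≤
      discreteDomainGraph (cellDomain S δ) δ)
    (hav : ∀ (η : SAW.DomainSAW (cellDomain (remainingVerts S P t) δ) δ t b),
      ∀ x ∈ η.walk.support.tail, x ∉ pw.support)
    (hk : pw.length = K) (η : SAW.DomainSAW (cellDomain (remainingVerts S P t) δ) δ t b)
    {j : ℕ} (h1 : K + 1 ≤ j) (h2 : j ≤ (glue pw hpw hle hav η).length) :
    (glue pw hpw hle hav η).walk.getVert j ∈ remainingVerts S P t := by
  rw [length_glue, hk] at h2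
  have hmap : ∀ m, (η.walk.mapLe hle).getVert m = η.walk.getVert m := fun m => by
    rw [SimpleGraph.Walk.getVert_eq_getD_support, SimpleGraph.Walk.support_mapLe_eq_support,
      ← SimpleGraph.Walk.getVert_eq_getD_support]
  rw [walk_glue, SimpleGraph.Walk.getVert_append, if_neg (by omega), hmap, hk]
  exact getVert_mem_remainingVerts hδ η (by omega) (by omega)

/-- **The remaining walk lives in the remaining domain with `F` deleted**: for a SAW `γ` of
`U(S, δ)` with prefix `p` (tip `t ∉ F`) visiting no vertex of `F` after time `K`, every edge of
`γ` after time `K` is an edge of `U(remainingVerts S ({p₀..p_{K-1}} ∪ F) t, δ)_δ`. [folklore] -/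
theorem drop_edges_mem_union (hδ : 0 < δ)
    (hS : ((zdGraph 2).induce (↑S : Set (Site 2))).Preconnected)
    (hpK : p.length = K + 1) (hpt : p.getLast? = some t) (htF : t ∉ F)
    (γ : SAW.DomainSAW (cellDomain S δ) δ a b) (hγ : γ.walk.support.take (K + 1) = p)
    (hγF : ∀ j : ℕ, K + 1 ≤ j → j ≤ γ.length → γ.walk.getVert j ∉ F) :
    ∀ e ∈ (γ.walk.drop K).edges, e ∈
      (discreteDomainGraph (cellDomain (remainingVerts S (p.dropLast.toFinset ∪ F) t) δ)
        δ).edgeSet := by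
  classical
  obtain ⟨hlen, hK⟩ := getVert_eq_of_take_eq γ.walk hpK hpt hγ
  have hsupp : (γ.walk.drop K).support = γ.walk.support.drop K := by
    rw [SimpleGraph.Walk.drop_support_eq_support_drop_min, Nat.min_eq_left hlen]
  -- the remaining vertices avoid the deleted prefix `p₀..p_{K-1}` (self-avoidance of `γ`)
  have hdis : ∀ v ∈ γ.walk.support.drop K, v ∉ p.dropLast := by
    intro v hv hv'
    have hnd := (SimpleGraph.Walk.isPath_def _).1 γ.isPath
    rw [← List.take_append_drop K γ.walk.support, List.nodup_append] at hnd
    have : p.dropLast = γ.walk.support.take K := by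
      rw [List.dropLast_eq_take, hpK, Nat.add_sub_cancel, ← hγ, List.take_take,
        Nat.min_eq_left (Nat.le_succ K)]
    rw [this] at hv'
    exact hnd.2.2 v hv' v hv rfl
  -- the remaining vertices avoid `F`: `t ∉ F` at time `K`, the hypothesis after time `K`
  have hdisF : ∀ v ∈ (γ.walk.drop K).support, v ∉ F := by
    intro v hv
    obtain ⟨n, hn, hnl⟩ := SimpleGraph.Walk.mem_support_iff_exists_getVert.1 hv
    rw [SimpleGraph.Walk.drop_getVert] at hn
    rw [SimpleGraph.Walk.drop_length] at hnl
    subst hn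
    rcases Nat.eq_zero_or_pos n with rfl | hn0
    · rw [Nat.add_zero, hK]; exact htF
    · exact hγF (K + n) (Nat.succ_le_of_lt (Nat.lt_add_of_pos_right hn0))
        (show K + n ≤ γ.walk.length by omega)
  -- a remaining vertex lying in `S` is joined to `t` inside `S ∖ ({p₀..p_{K-1}} ∪ F)`
  have hmem : ∀ x ∈ (γ.walk.drop K).support, x ∈ S →
      x ∈ remainingVerts S (p.dropLast.toFinset ∪ F) t := by
    intro x hx hxS
    have hx' : x ∈ ((γ.walk.drop K).copy hK rfl).support := by
      rw [SimpleGraph.Walk.support_copy]; exact hx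
    refine mem_remainingVerts_of_walk
      ((((γ.walk.drop K).copy hK rfl).takeUntil x hx').mapLe
        ((discreteDomainGraph_le_meshGraph _ _).trans (meshGraph_le_zdGraph _ _)))
      fun v hv => ?_
    rw [SimpleGraph.Walk.support_mapLe_eq_support] at hv
    have hv' : v ∈ (γ.walk.drop K).support := by
      rw [← SimpleGraph.Walk.support_copy _ hK rfl]
      exact SimpleGraph.Walk.support_takeUntil_subset_support _ _ hv
    refine ⟨support_subset_of_adj_closed (T := (↑S : Set (Site 2)))
      (fun x y h => ((cellGraph_adj_iff hδ hS).1 h).2.1) _ hxS v hv, ?_⟩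
    rw [Finset.mem_union, not_or, List.mem_toFinset]
    exact ⟨hdis v (hsupp ▸ hv'), hdisF v hv'⟩
  intro e he
  induction e using Sym2.ind with
  | h x y =>
    obtain ⟨hzd, hxS, hyS⟩ := (cellGraph_adj_iff hδ hS).1 ((γ.walk.drop K).adj_of_mem_edges he)
    rw [SimpleGraph.mem_edgeSet, remGraph_adj_iff hδ]
    exact ⟨hzd, hmem x ((γ.walk.drop K).fst_mem_support_of_mem_edges he) hxS,
      hmem y ((γ.walk.drop K).snd_mem_support_of_mem_edges he) hyS⟩

/-! ### The identity -/

/-- **Factorisation of the critical weights over the prefix event with a forbidden set.** If some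
SAW of `U(S, δ)` from `a` to `b` has prefix `p` (tip `t ∉ F`), then for every set `B` of curve
classes the weight of {prefix `= p`, no visit to `F` after time `K`, remaining polyline `∈ B`} is
`x_c^K` times the weight of {polyline `∈ B`} for the SAWs of the remaining domain with `F`
deleted, from the tip `t` to `b` (gluing is a weight-respecting bijection). [folklore] -/
theorem weight_prefix_inter_union (hδ : 0 < δ)
    (hS : ((zdGraph 2).induce (↑S : Set (Site 2))).Preconnected)
    (hpK : p.length = K + 1) (hpt : p.getLast? = some t) (htF : t ∉ F)
    (γ₀ : SAW.DomainSAW (cellDomain S δ) δ a b) (hγ₀ : γ₀.walk.support.take (K + 1) = p)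
    (B : Set (CurveClass ℂ)) :
    SAW.weight (cellDomain S δ) δ a b
        {γ | γ.walk.support.take (K + 1) = p ∧
          (∀ j : ℕ, K + 1 ≤ j → j ≤ γ.length → γ.walk.getVert j ∉ F) ∧
          CurveClass.mk ⟨(γ.walk.drop K).toCurve (meshPoint δ)⟩ ∈ B} =
      ENNReal.ofReal (SAW.criticalFugacity ^ K) *
        SAW.weight (cellDomain (remainingVerts S (p.dropLast.toFinset ∪ F) t) δ) δ t b
          {η | η.curve ∈ B} := by
  set pw := prefixWalk γ₀ hpK hpt hγ₀
  have hsupp : pw.support = p := support_prefixWalk γ₀ hpK hpt hγ₀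
  have hlenK : pw.length = K := length_prefixWalk γ₀ hpK hpt hγ₀
  have hpw : pw.IsPath := isPath_prefixWalk γ₀ hpK hpt hγ₀
  have hle := remGraph_le (P := p.dropLast.toFinset ∪ F) (t := t) hδ hS
  have hav : ∀ η : SAW.DomainSAW (cellDomain (remainingVerts S (p.dropLast.toFinset ∪ F) t) δ)
      δ t b, ∀ x ∈ η.walk.support.tail, x ∉ pw.support := by
    intro η x hx
    rw [hsupp]
    exact not_mem_prefix_of_mem_tail_union hδ hpt η hx
  -- glued SAWs avoid `F` after time `K`
  have hF : ∀ η : SAW.DomainSAW (cellDomain (remainingVerts S (p.dropLast.toFinset ∪ F) t) δ)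
      δ t b, ∀ j : ℕ, K + 1 ≤ j → j ≤ (glue pw hpw hle hav η).length →
        (glue pw hpw hle hav η).walk.getVert j ∉ F := fun η j h1 h2 hjF =>
    (mem_and_not_mem_of_mem_remainingVerts
      (getVert_glue_mem_remainingVerts hδ pw hpw hle hav hlenK η h1 h2)).2
      (Finset.mem_union_right _ hjF)
  rw [weight_apply_tsum, weight_apply_tsum, ← ENNReal.tsum_mul_left]
  refine (((glue_injective pw hpw hle hav).tsum_eq ?_).symm.trans (tsum_congr fun η => ?_))
  · intro γ hγ
    have hγ' := Set.support_indicator_subset hγ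
    exact exists_glue_eq pw hpw hle hav hlenK γ (by rw [hsupp]; exact hγ'.1)
      (drop_edges_mem_union hδ hS hpK hpt htF γ hγ'.1 hγ'.2.1)
  · by_cases hB : η.curve ∈ B
    · have hmem : glue pw hpw hle hav η ∈ {γ : SAW.DomainSAW (cellDomain S δ) δ a b |
          γ.walk.support.take (K + 1) = p ∧
            (∀ j : ℕ, K + 1 ≤ j → j ≤ γ.length → γ.walk.getVert j ∉ F) ∧
            CurveClass.mk ⟨(γ.walk.drop K).toCurve (meshPoint δ)⟩ ∈ B} := by
        refine ⟨?_, hF η, ?_⟩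
        · rw [take_support_glue pw hpw hle hav hlenK, hsupp]
        · rw [curve_drop_glue pw hpw hle hav hlenK]; exact hB
      have hmem' : η ∈ {η : SAW.DomainSAW
          (cellDomain (remainingVerts S (p.dropLast.toFinset ∪ F) t) δ) δ t b | η.curve ∈ B} := hB
      -- `x_c = μ⁻¹ ≥ 0`: `μ = infₙ c_{n+1}^{1/(n+1)}` is an infimum of nonnegative reals
      have hxc : 0 ≤ SAW.criticalFugacity :=
        inv_nonneg.2 (Real.iInf_nonneg fun _ => Real.rpow_nonneg (Nat.cast_nonneg _) _)
      rw [Set.indicator_of_mem hmem, Set.indicator_of_mem hmem', length_glue, hlenK, pow_add,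
        ENNReal.ofReal_mul (pow_nonneg hxc _)]
    · have hmem : glue pw hpw hle hav η ∉ {γ : SAW.DomainSAW (cellDomain S δ) δ a b |
          γ.walk.support.take (K + 1) = p ∧
            (∀ j : ℕ, K + 1 ≤ j → j ≤ γ.length → γ.walk.getVert j ∉ F) ∧
            CurveClass.mk ⟨(γ.walk.drop K).toCurve (meshPoint δ)⟩ ∈ B} := by
        intro h
        rw [Set.mem_setOf_eq, curve_drop_glue pw hpw hle hav hlenK] at h
        exact hB h.2.2
      have hmem' : η ∉ {η : SAW.DomainSAW
          (cellDomain (remainingVerts S (p.dropLast.toFinset ∪ F) t) δ) δ t b | η.curve ∈ B} := hB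
      rw [Set.indicator_of_notMem hmem, Set.indicator_of_notMem hmem', mul_zero]

/-- **The domain Markov identity with a forbidden set, at a fixed prefix length**
(`p.length = K + 1`). [folklore] -/
theorem law_prefix_eq_union (hδ : 0 < δ)
    (hS : ((zdGraph 2).induce (↑S : Set (Site 2))).Preconnected)
    (hpK : p.length = K + 1) (hpt : p.getLast? = some t) (htF : t ∉ F)
    (B : Set (CurveClass ℂ)) (hB : MeasurableSet B) :
    SAW.law (cellDomain S δ) δ a b
        {γ | γ.walk.support.take (K + 1) = p ∧
          (∀ j : ℕ, K + 1 ≤ j → j ≤ γ.length → γ.walk.getVert j ∉ F) ∧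
          CurveClass.mk ⟨(γ.walk.drop K).toCurve (meshPoint δ)⟩ ∈ B} =
      SAW.law (cellDomain S δ) δ a b
          {γ | γ.walk.support.take (K + 1) = p ∧
            ∀ j : ℕ, K + 1 ≤ j → j ≤ γ.length → γ.walk.getVert j ∉ F} *
        (SAW.law (cellDomain (remainingVerts S (p.dropLast.toFinset ∪ F) t) δ) δ t b).map
          (fun γ => γ.curve) B := by
  rw [Measure.map_apply (SAW.DomainSAW.measurable_of_top _) hB]
  simp only [SAW.law, Measure.smul_apply, smul_eq_mul]
  by_cases hE : ∃ γ₀ : SAW.DomainSAW (cellDomain S δ) δ a b, γ₀.walk.support.take (K + 1) = p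
  · obtain ⟨γ₀, hγ₀⟩ := hE
    have h1 := weight_prefix_inter_union hδ hS hpK hpt htF γ₀ hγ₀ B
    have h2 := weight_prefix_inter_union hδ hS hpK hpt htF γ₀ hγ₀ univ
    have e1 : {γ : SAW.DomainSAW (cellDomain S δ) δ a b | γ.walk.support.take (K + 1) = p ∧
        (∀ j : ℕ, K + 1 ≤ j → j ≤ γ.length → γ.walk.getVert j ∉ F) ∧
        CurveClass.mk ⟨(γ.walk.drop K).toCurve (meshPoint δ)⟩ ∈ (univ : Set (CurveClass ℂ))} =
        {γ | γ.walk.support.take (K + 1) = p ∧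
          ∀ j : ℕ, K + 1 ≤ j → j ≤ γ.length → γ.walk.getVert j ∉ F} := by
      ext γ; simp
    have e2 : {η : SAW.DomainSAW (cellDomain (remainingVerts S (p.dropLast.toFinset ∪ F) t) δ)
        δ t b | η.curve ∈ (univ : Set (CurveClass ℂ))} = univ := by
      ext η; simp
    rw [e1, e2] at h2
    rw [h1, h2]
    -- notation
    set c := ENNReal.ofReal (SAW.criticalFugacity ^ K)
    set ZS := SAW.weight (cellDomain S δ) δ a b univ
    set ZR := SAW.weight (cellDomain (remainingVerts S (p.dropLast.toFinset ∪ F) t) δ) δ t b univ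
    set W := SAW.weight (cellDomain (remainingVerts S (p.dropLast.toFinset ∪ F) t) δ) δ t b
      ((fun γ => γ.curve) ⁻¹' B)
    change ZS⁻¹ * (c * W) = ZS⁻¹ * (c * ZR) * (ZR⁻¹ * W)
    have hWZ : W ≤ ZR := measure_mono (subset_univ _)
    rcases eq_or_ne ZR 0 with h0 | h0
    · have hW : W = 0 := le_antisymm (h0 ▸ hWZ) zero_le
      simp [hW, h0]
    rcases eq_or_ne ZR ⊤ with htop | htop
    · by_cases hc : c = 0
      · simp [hc]
      · have hZS : ZS = ⊤ := by
          refine top_unique ?_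
          calc (⊤ : ℝ≥0∞) = c * ZR := by rw [htop, ENNReal.mul_top hc]
            _ = SAW.weight (cellDomain S δ) δ a b {γ | γ.walk.support.take (K + 1) = p ∧
                  ∀ j : ℕ, K + 1 ≤ j → j ≤ γ.length → γ.walk.getVert j ∉ F} := h2.symm
            _ ≤ ZS := measure_mono (subset_univ _)
        simp [hZS]
    · calc ZS⁻¹ * (c * W) = ZS⁻¹ * (c * W) * (ZR * ZR⁻¹) := by
            rw [ENNReal.mul_inv_cancel h0 htop, mul_one]
        _ = ZS⁻¹ * (c * ZR) * (ZR⁻¹ * W) := by ring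
  · have hE1 : {γ : SAW.DomainSAW (cellDomain S δ) δ a b | γ.walk.support.take (K + 1) = p ∧
        ∀ j : ℕ, K + 1 ≤ j → j ≤ γ.length → γ.walk.getVert j ∉ F} = ∅ := by
      ext γ
      simp only [mem_setOf_eq, mem_empty_iff_false, iff_false, not_and]
      exact fun h _ => hE ⟨γ, h⟩
    have hE2 : {γ : SAW.DomainSAW (cellDomain S δ) δ a b | γ.walk.support.take (K + 1) = p ∧
        (∀ j : ℕ, K + 1 ≤ j → j ≤ γ.length → γ.walk.getVert j ∉ F) ∧
        CurveClass.mk ⟨(γ.walk.drop K).toCurve (meshPoint δ)⟩ ∈ B} = ∅ := by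
      ext γ
      simp only [mem_setOf_eq, mem_empty_iff_false, iff_false, not_and]
      exact fun h _ _ => hE ⟨γ, h⟩
    rw [hE1, hE2, measure_empty, mul_zero, zero_mul]

end ForbiddenMarkov

/-- **STUB `stub_forbiddenDomainMarkov` of the line `past-shadowing-costs-halves` — the exact
domain Markov property of the critical SAW law on cell domains with a forbidden set** (verbatim
the registered signature): conditioning the critical SAW of `U(S, δ)` from `a` to `b` on
{prefix `= p` (tip `t ∉ F`), no visit to `F` after the prefix} leaves the critical SAW of the
remaining cell domain with `F` deleted, `U(remainingVerts S ({p₀..p_{K-1}} ∪ F) t, δ)`, from `t`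
to `b`; from `law_prefix_eq_union` at `K = p.length - 1`. [folklore] -/
theorem stub_forbiddenDomainMarkov :
    ∀ (S F : Finset (Site 2)) (δ : ℝ) (a b : Site 2) (p : List (Site 2)) (t : Site 2), 0 < δ →
      ((zdGraph 2).induce (↑S : Set (Site 2))).Preconnected → p ≠ [] → p.getLast? = some t → t ∉ F →
      ∀ B : Set (CurveClass ℂ), MeasurableSet B →
        SAW.law (cellDomain S δ) δ a b
            {γ | γ.walk.support.take p.length = p ∧
              (∀ j : ℕ, p.length ≤ j → j ≤ γ.length → γ.walk.getVert j ∉ F) ∧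
              CurveClass.mk ⟨(γ.walk.drop (p.length - 1)).toCurve (meshPoint δ)⟩ ∈ B} =
          SAW.law (cellDomain S δ) δ a b
              {γ | γ.walk.support.take p.length = p ∧
                ∀ j : ℕ, p.length ≤ j → j ≤ γ.length → γ.walk.getVert j ∉ F} *
            (SAW.law (cellDomain (remainingVerts S ((p.dropLast).toFinset ∪ F) t) δ) δ t b).map
              (fun γ => γ.curve) B := by
  intro S F δ a b p t hδ hS hp hpt htF B hB
  obtain ⟨K, hK⟩ : ∃ K, p.length = K + 1 :=
    ⟨p.length - 1, (Nat.succ_pred_eq_of_pos (List.length_pos_iff.2 hp)).symm⟩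
  rw [hK, Nat.add_sub_cancel]
  exact law_prefix_eq_union hδ hS hK hpt htF B hB

end Summit.CriticalPhenomena.SAWScalingLimit.Theorems.SimpleSubseqLimits.CapacityClock.DomainMarkov
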